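import Literature.MathematicalPhysics.QuantumFieldTheory.Balaban1983to89.B6Ineq2140KLevelV1
import Literature.MathematicalPhysics.QuantumFieldTheory.Balaban1983to89.B6Prop26GradKLevelV1
import HarnessLib

/-!
# `Balaban1983to89.B6Ineq2140KLevelPadV1` — T. Bałaban, *Propagators and renormalization transformations for lattice gauge theories. II*,
# Commun. Math. Phys. **96** (1984) 223–250 [Balaban1984PropagatorsII], Proposition 2.6, THE `L²` ENTRIES (2.140)₁ AND (2.140)₂ p. 247 AT k LEVELS FOR THE
# GENUINE `G = Δ_a⁻¹` ON THE V1 TORUS — (2.140)₁ FOR EVERY ODD `L ≥ 5` WITHOUT THE PLACEMENT HYPOTHESIS (p38's padded family), AND (2.140)₂ MODULO THE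
# SUP ENTRY (2.136)₃ (sibling of `B6Ineq2140KLevelV1`; B6-CLOSURE §5 item 16 addendum «(2.137)–(2.141) at k levels»)

statement-level skeleton of published theorems with citation tags; proofs where landed; nothing here is a claim about the Yang–Mills mass gap

WHAT IS PRINTED (p. 247 [PDF 25], Proposition 2.6, verbatim up to notation): *"|(GJ)(x)|, |(∇GJ)(x)|, |(G∇*J)(x)|, |(ΔGJ)(x)| ≤ O(1)[(Lʲη)², Lʲη, Lʲη, 1]
e^{−δ₃d(y,y′)}|J| (2.136) for x ∈ Δ(y), y ∈ Λ_j, supp J ⊂ Δ(y′) … ‖ζGJ‖, ‖ζ∇GJ‖, ‖ζG∇*J‖, ‖ζ∇G∇*J‖, ‖ζ∇∇GJ‖, ‖ζG∇*∇*J‖ ≤ O(1)[(Lʲη)², Lʲη, Lʲη,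
1, 1, 1]|ζ|e^{−δ₃d(y,y′)}‖J‖ (2.140) if supp ζ ⊂ Δ(y), y ∈ Λ_j, supp J ⊂ Δ(y′), with the constant O(1) depending on d and L."*

CITATION HEADER (lean-in-tree rule) — WHAT IS REPRODUCED.  Phase-2 file of the `lit-balaban` typed skeleton (HOME `run/shared/lean/pub/lit-balaban/`),
seat **p22 gen 23**, lane B6 §C (fold owner r03, referee ref-4); SKELETON row **B6.Prop2.6** (member cells; the head is r03's).  Sibling of
`B6Ineq2140KLevelV1` (p368613: the Schur test on one block pair `sum_sq_cut_apply_le_of_hasMajorant_pair` — the same device as p21's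
`B9Ineq346GpFlatMultiLevelTorus.l2_block_sq_le` ((3.46) at `U = 1` for the SCALAR `G′`, matrices on `boxDom`), here on `B6RandomWalk.HasMajorant` for an
arbitrary carrier — `adjoint_GE`, `pref_le_of_levelGap`, `sum_sq_le_of_hasMajorant_GE`, `absorb_of_threshold`, `ineq2140_kLevel_unconditional(_L5)`), with
p38's `B6Prop26GradKLevelV1.prop26_2136_grad_kLevel_unconditional_pad_V1` ((2.136)₁ ∧ (2.136)₂ at k levels via the padded family, p367862) BY NAME:
* §1 **`ineq2140_kLevel_unconditional_pad_V1`** — (2.140)₁ `Σ_x (ζ(x)(GJ)(x))² ≤ (A·pref cf y·e^{−(δ₃(α,2σ)/2)d_T(y,y′)}·s)²·Σ_x J(x)²` FOR EVERY ODD `L ≥ 5`,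
  `k ≥ 1`, `P′_μ ≥ 5L`, WITH NO PLACEMENT HYPOTHESIS (binders of p38's theorem VERBATIM except `α < 1`, `M₂` enlarged by `2 log L/δ₃ + 1`; its first
  conjunct feeds `sum_sq_le_of_hasMajorant_GE`);
* §2 **`sum_sq_le_of_hasMajorant_pair_len`** — THE SCHUR STEP FOR THE (2.140)₂/(2.140)₃ SHAPE: a transpose pair `T, T′` (`T′δ_x(x′) = Tδ_{x′}(x)`) of
  endomorphisms of the fine bond functions BOTH carrying the (2.136)₂/(2.136)₃-shape majorant `A·(len y·|c′|⁻¹)·e^{−δd_T}` gives `Σ_x(ζ(x)(TJ)(x))² ≤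
  (A·L·(len y·|c′|⁻¹)·e^{−(δ/2)d_T(y,y′)}·s)²·Σ_x J(x)²` (`len_le_of_levelGap`: `len y′ ≤ L·e^{(δ/2)d_T}·len y` once `2 log L ≤ δ·(R·L·M_h − 1)`);
* §3 **`ineq2140_grad_kLevel_pad_V1_of_transpose`** — (2.140)₂ `‖ζ∇GJ‖` at k levels for `∇_νG = DV ν c′ ∘ onFun G` (p38's (2.136)₂ = the SECOND conjunct,
  BY NAME) MODULO a displayed (2.136)₃-shape majorant of ANY `T′` with the transposed entries of `∇_νG` (print's `G∇_ν*`, since `G† = G`,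
  `B6Ineq2140KLevelV1.adjoint_GE`) with the same constant `A` — the sup entry (2.136)₃ at k levels is NOT in the tree; when it lands in this shape,
  (2.140)₂ follows from §3 and (2.140)₃ symmetrically from §2, in one line each;
* §4 **`abs_inner_GE_le`** — THE `ℓ²`-BLOCK (operator) FORM of (2.140)₁ on `BondSpace` = `ℓ²(fine bonds)`: `|⟪v, Gu⟫| ≤ A·L·pref cf y·e^{−(δ/2)d_T(y,y′)}·‖v‖‖u‖`
  for `v`, `u` supported in the blocks `Δ(y)`, `Δ(y′)` (the hypothesis shape of the `ℓ²` block calculus `B6L2BlockCalculus.l2blk_*`), from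
  `sum_sq_le_of_hasMajorant_GE` with the indicator cut-off and Cauchy–Schwarz.
HONEST SCOPE: as `B6Ineq2140KLevelV1` — unweighted `ℓ²` sums over the fine bonds on both sides; rates `δ₃/2` and constants `A·L` OURS; §3 is CONDITIONAL on
its displayed (2.136)₃ hypothesis (a binder, not a vendored fact); (2.140)₄₋₆ are not reachable by the Schur test (Calderón–Zygmund kernels) and are not
attempted; V1 torus with `k ≥ 1`, `M_h = L^a ≥ 8`, `R ≥ 2L²`, `P′_μ ≥ 5L`, odd `L ≥ 5`, weights in the band (2.16), `M₂ ≤ L·M_h`.  IMPORTS BY NAME,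
restating nothing; THEOREMS ONLY (no definition, no `def … : Prop`); standard axioms.  NOT summit progress.  Unit `lit-balaban-p22` (gen 23), 2026-08-23.
-/

noncomputable section

open scoped BigOperators InnerProductSpace
open Finset

namespace Literature.MathematicalPhysics.QuantumFieldTheory.Balaban1983to89.B6Ineq2140KLevelPadV1

open LatticeFieldCalculus
open BalabanImbrieJaffe1984to88.BIJ85AxialPropagator411 (BondSpace)
open B6RandomWalk (HasMajorant hasMajorant_mono BlockSupp delta3 delta3_pos)
open B6Ineq2133TwoScaleV1 (onFun onFun_apply)
open B6SectAOperatorsV1 (BondIdx inner_eq_sum)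
open B6SectAVectorModelV1 (GE)
open B6MultiLevelBoxOperator (N0)
open B6MultiLevelTorusOperator (TDomains)
open B6Geom246MultiLevelTorus (geomT bondT)
open B6GlobalChartV1 (PV domT blkV1)
open B6Prop26KLevelSkeletonV1 (pref pref_nonneg)
open B6CubeWindowV1 (GlobalBand)
open B6GradLegKLevelV1 (DV)
open B6Prop26GradKLevelV1 (prop26_2136_grad_kLevel_unconditional_pad_V1)
open B6Ineq2140KLevelV1 (sum_sq_cut_apply_le_of_hasMajorant_pair sum_sq_le_of_hasMajorant_GE absorb_of_threshold geomT_dist_eq geomT_dist_nonneg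
  powL_sq_le_of_levelGap)

/-! ## §1  (2.140)₁ for every odd `L ≥ 5` without the placement hypothesis (via p38's padded family) -/

section Pad

/-- **PROPOSITION 2.6, THE FIRST `L²` ENTRY OF (2.140), AT k LEVELS FOR THE GENUINE `G`, FOR EVERY ODD `L ≥ 5`, `k ≥ 1`, `P′_μ ≥ 5L`, WITH NO
PLACEMENT HYPOTHESIS** — binders of p38's `B6Prop26GradKLevelV1.prop26_2136_grad_kLevel_unconditional_pad_V1` VERBATIM with `α < 1` (its first
conjunct, the sup entry (2.136)₁ obtained through the padded family, is the input of `sum_sq_le_of_hasMajorant_GE`; `M₂` enlarged by `2 log L/δ₃ + 1`):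
`Σ_x (ζ(x)(GJ)(x))² ≤ (A·pref cf y·e^{−(δ₃(α,2σ)/2)d_T(y,y′)}·s)²·Σ_x J(x)²` for `supp ζ ⊂ Δ(y)`, `|ζ| ≤ s`, `supp J ⊂ Δ(y′)`.
[cite: Balaban1984PropagatorsII, Prop. 2.6 (2.140) p.247 (first entry), (2.136) p.247, (2.2) p.224] -/
theorem ineq2140_kLevel_unconditional_pad_V1 (d ℓ : ℕ) (hd : 1 ≤ d + 1) (hL : Odd (ℓ + 1) ∧ 1 < ℓ + 1) {b₀ b₁ : ℝ} (hb₀ : 0 < b₀)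
    (hb₁ : b₀ ≤ b₁) :
    ∃ σ₁ : ℝ, 0 < σ₁ ∧ ∀ (σ : ℝ), 0 < σ → σ ≤ σ₁ → ∀ (α : ℝ), 0 < α → α < 1 →
    ∃ A M₂ : ℝ, 0 ≤ A ∧ 0 < M₂ ∧
    ∀ (m K : ℕ) {Mh k R : ℕ} {P' : Fin (d + 1) → ℕ}
      (hN : ∀ μ, N0 ℓ Mh k P' μ = (PV d ℓ m K hd hL).sitesPerDir 0) (D : TDomains d ℓ Mh k P' R) (hk : k ≤ m + K) (_ : 1 ≤ k)
      {a : ℕ} (_ : Mh = (ℓ + 1) ^ a) (_ : 8 ≤ Mh) (_ : 2 * (ℓ + 1) ^ 2 ≤ R) (_ : ∀ μ, 5 * (ℓ + 1) ≤ P' μ) (_ : 4 ≤ ℓ)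
      (_ : M₂ ≤ ((ℓ : ℝ) + 1) * Mh)
      {cf : ℝ} (hcf : cf ≠ 0) {w : BondIdx (domT hN D hk) → ℝ} (hw : ∀ i, 0 < w i) (_ : GlobalBand b₀ b₁ cf w)
      (y y' : (geomT D).Site) (ζ J : PBond (PV d ℓ m K hd hL) 0 → ℝ) {s : ℝ}
      (_ : ∀ x, blkV1 hN D x ≠ y → ζ x = 0) (_ : ∀ x, |ζ x| ≤ s) (_ : ∀ x, blkV1 hN D x ≠ y' → J x = 0),
      ∑ x, (ζ x * onFun (GE (domT hN D hk) hcf hw) J x) ^ 2 ≤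
        (A * pref cf y * Real.exp (-(delta3 α (2 * σ) / 2 * (geomT D).dist y y')) * s) ^ 2 * ∑ x, J x ^ 2 := by
  obtain ⟨σ₁, hσ₁, h⟩ := prop26_2136_grad_kLevel_unconditional_pad_V1 d ℓ hd hL hb₀ hb₁
  refine ⟨σ₁, hσ₁, fun σ hσ hσ1 α hα hα1 => ?_⟩
  obtain ⟨A, M₂, hA, hM₂, h2⟩ := h σ hσ hσ1 α hα hα1.le
  have hδ : 0 < delta3 α (2 * σ) := delta3_pos hα1 (by linarith)
  refine ⟨A * ((ℓ : ℝ) + 1), max M₂ (2 * Real.log ((ℓ : ℝ) + 1) / delta3 α (2 * σ) + 1),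
    mul_nonneg hA (by positivity), lt_max_of_lt_left hM₂, ?_⟩
  intro m K Mh k R P' hN D hk hk1 a hMha hM8 hR2 hP5L hℓ hM cf hcf w hw hwb y y' ζ J s hζ hζs hJ
  have hT := (h2 m K hN D hk hk1 hMha hM8 hR2 hP5L hℓ ((le_max_left _ _).trans hM) hcf hw hwb).1
  have habs := absorb_of_threshold (R := R) hδ (by omega) (by omega) hR2 ((le_max_right _ _).trans hM)
  exact sum_sq_le_of_hasMajorant_GE hN D hk (by omega) (fun μ => le_trans (by omega) (hP5L μ)) hcf hw hA hδ.le habs hT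
    y y' ζ J hζ hζs hJ

end Pad

/-! ## §2  The Schur step for the (2.140)₂/(2.140)₃ shape: a transpose pair with `len`-prefactor majorants -/

section PairLen

variable {d ℓ m K : ℕ} {hd : 1 ≤ d + 1} {hL : Odd (ℓ + 1) ∧ 1 < ℓ + 1} {Mh k R : ℕ} {P' : Fin (d + 1) → ℕ}

/-- the printed length `len y = L^{j(y)}` of the torus geometry (`η = 1`). [cite: Balaban1984PropagatorsII, (2.136) p.247 (the prefactor `Lʲη`), dictionary] -/
theorem geomT_len_eq (D : TDomains d ℓ Mh k P' R) (y : (geomT D).Site) : (geomT D).len y = (((ℓ : ℝ) + 1)) ^ y.1.1 := by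
  rw [B8Ineq192MultiLevelTorus.geomT_len, mul_one]

/-- **THE LEVEL FACTOR FOR `len`**: `len y′ ≤ L·e^{(δ/2)d_T(y,y′)}·len y` whenever `2 log L ≤ δ·(R·L·M_h − 1)` (square root of `powL_sq_le_of_levelGap`).
[cite: Balaban1984PropagatorsII, (2.136)/(2.140) p.247 (the prefactor `Lʲη` of the output block), (2.2) p.224; derivation ours] -/
theorem len_le_of_levelGap (D : TDomains d ℓ Mh k P' R) (hMh : 1 ≤ Mh) (hP : ∀ μ, 1 ≤ P' μ) {δ : ℝ} (hδ : 0 ≤ δ)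
    (habs : 2 * Real.log ((ℓ : ℝ) + 1) ≤ δ * (((R * ((ℓ + 1) * Mh) - 1 : ℕ)) : ℝ)) (y y' : (geomT D).Site) :
    (geomT D).len y' ≤ ((ℓ : ℝ) + 1) * Real.exp (δ / 2 * (geomT D).dist y y') * (geomT D).len y := by
  rw [geomT_len_eq, geomT_len_eq]
  have hsq := powL_sq_le_of_levelGap D hMh hP hδ habs y y'
  have hL0 : (0 : ℝ) ≤ (ℓ : ℝ) + 1 := by positivity
  have hb : (((ℓ : ℝ) + 1) * Real.exp (δ / 2 * (geomT D).dist y y') * ((ℓ : ℝ) + 1) ^ y.1.1) ^ 2 =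
      ((ℓ : ℝ) + 1) ^ 2 * Real.exp (δ * (geomT D).dist y y') * (((ℓ : ℝ) + 1) ^ y.1.1) ^ 2 := by
    rw [mul_pow, mul_pow, sq (Real.exp _), ← Real.exp_add]
    congr 2; ring
  rw [← hb] at hsq
  exact (pow_le_pow_iff_left₀ (pow_nonneg hL0 _) (by positivity) two_ne_zero).mp hsq

/-- **THE SCHUR STEP FOR THE (2.140)₂/(2.140)₃ SHAPE**: if `T` and a `T′` with the transposed entries (`T′δ_x(x′) = Tδ_{x′}(x)`) both carry the
(2.136)₂/(2.136)₃-shape majorant `A·(len y·|c′|⁻¹)·e^{−δd_T(y,y′)}` on the blocks of the V1 torus (`A, δ ≥ 0`) and `2 log L ≤ δ·(R·L·M_h − 1)`, then for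
`supp ζ ⊂ Δ(y)`, `|ζ| ≤ s`, `supp J ⊂ Δ(y′)`: `Σ_x (ζ(x)(TJ)(x))² ≤ (A·L·(len y·|c′|⁻¹)·e^{−(δ/2)d_T(y,y′)}·s)²·Σ_x J(x)²`.  Intended instance:
`T := DV ν c′ ∘ onFun G` (`∇_νG`, p38's (2.136)₂) and `T′` := the bond-function reading of `G∇_ν*` (= `(∇_νG)ᵀ` since `G† = G`), whose majorant is the
sup entry (2.136)₃ at k levels (not in the tree). [cite: Balaban1984PropagatorsII, Prop. 2.6 (2.140) p.247 (entries 2, 3; shape), (2.136) p.247; derivation ours] -/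
theorem sum_sq_le_of_hasMajorant_pair_len (hN : ∀ μ, N0 ℓ Mh k P' μ = (PV d ℓ m K hd hL).sitesPerDir 0) (D : TDomains d ℓ Mh k P' R)
    (hMh : 1 ≤ Mh) (hP : ∀ μ, 1 ≤ P' μ) (cf : ℝ) {T T' : Module.End ℝ (PBond (PV d ℓ m K hd hL) 0 → ℝ)}
    (htr : ∀ x x', T' (Pi.single x 1) x' = T (Pi.single x' 1) x)
    {A δ : ℝ} (hA : 0 ≤ A) (hδ : 0 ≤ δ) (habs : 2 * Real.log ((ℓ : ℝ) + 1) ≤ δ * (((R * ((ℓ + 1) * Mh) - 1 : ℕ)) : ℝ))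
    (hT : HasMajorant (g := geomT D) (blkV1 hN D) T
      (fun y y' => A * ((geomT D).len y * |cf|⁻¹) * Real.exp (-(δ * (geomT D).dist y y'))))
    (hT' : HasMajorant (g := geomT D) (blkV1 hN D) T'
      (fun y y' => A * ((geomT D).len y * |cf|⁻¹) * Real.exp (-(δ * (geomT D).dist y y'))))
    (y y' : (geomT D).Site) (ζ J : PBond (PV d ℓ m K hd hL) 0 → ℝ) {s : ℝ}
    (hζ : ∀ x, blkV1 hN D x ≠ y → ζ x = 0) (hζs : ∀ x, |ζ x| ≤ s) (hJ : ∀ x, blkV1 hN D x ≠ y' → J x = 0) :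
    ∑ x, (ζ x * T J x) ^ 2 ≤
      (A * ((ℓ : ℝ) + 1) * ((geomT D).len y * |cf|⁻¹) * Real.exp (-(δ / 2 * (geomT D).dist y y')) * s) ^ 2 * ∑ x, J x ^ 2 := by
  classical
  have hlen0 : ∀ y : (geomT D).Site, 0 ≤ (geomT D).len y := fun y => by rw [geomT_len_eq]; positivity
  have hK : ∀ y y' : (geomT D).Site, 0 ≤ A * ((geomT D).len y * |cf|⁻¹) * Real.exp (-(δ * (geomT D).dist y y')) := fun y y' =>
    mul_nonneg (mul_nonneg hA (mul_nonneg (hlen0 y) (inv_nonneg.mpr (abs_nonneg _)))) (Real.exp_nonneg _)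
  have h1 := sum_sq_cut_apply_le_of_hasMajorant_pair (blkV1 hN D) hT hT' hK hK htr y y' ζ J hζ hζs hJ
  refine h1.trans (mul_le_mul_of_nonneg_right ?_ (Finset.sum_nonneg fun x _ => sq_nonneg _))
  have hsymm : (geomT D).dist y' y = (geomT D).dist y y' := by
    rw [geomT_dist_eq, geomT_dist_eq, SimpleGraph.dist_comm]
  have hlev := len_le_of_levelGap D hMh hP hδ habs y y'
  have hd0 : 0 ≤ (geomT D).dist y y' := geomT_dist_nonneg D y y'
  have hL1 : (1 : ℝ) ≤ (ℓ : ℝ) + 1 := by linarith [(Nat.cast_nonneg ℓ : (0 : ℝ) ≤ ℓ)]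
  set Lr : ℝ := (ℓ : ℝ) + 1 with hLr
  set E : ℝ := Real.exp (-(δ * (geomT D).dist y y')) with hE
  set Eh : ℝ := Real.exp (δ / 2 * (geomT D).dist y y') with hEh
  set ly : ℝ := (geomT D).len y with hly
  set ly' : ℝ := (geomT D).len y' with hly'
  have hE2 : E * Eh = Real.exp (-(δ / 2 * (geomT D).dist y y')) := by
    rw [hE, hEh, ← Real.exp_add]; congr 1; ring
  have hEh1 : 1 ≤ Eh := Real.one_le_exp (by positivity)
  have hLE : Lr * Eh ≤ (Lr * Eh) ^ 2 := le_self_pow₀ (one_le_mul_of_one_le_of_one_le hL1 hEh1) two_ne_zero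
  have hE0 : 0 ≤ E := Real.exp_nonneg _
  have hly0 : 0 ≤ ly := hlen0 y
  -- `K(y,y′)K′(y′,y) = A²·ly·ly′·|c′|⁻²·E²` and `ly′ ≤ L·Eh·ly`, `L·Eh ≥ 1`
  calc s ^ 2 * (A * (ly * |cf|⁻¹) * E * (A * (ly' * |cf|⁻¹) * Real.exp (-(δ * (geomT D).dist y' y))))
      = s ^ 2 * ((A ^ 2 * ly * |cf|⁻¹ ^ 2 * (E * E)) * ly') := by rw [hsymm, ← hE]; ring
    _ ≤ s ^ 2 * ((A ^ 2 * ly * |cf|⁻¹ ^ 2 * (E * E)) * (Lr * Eh * ly)) := by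
        refine mul_le_mul_of_nonneg_left (mul_le_mul_of_nonneg_left hlev ?_) (sq_nonneg _)
        exact mul_nonneg (mul_nonneg (mul_nonneg (sq_nonneg _) hly0) (sq_nonneg _)) (mul_nonneg hE0 hE0)
    _ = (A * (ly * |cf|⁻¹) * E * s) ^ 2 * (Lr * Eh) := by ring
    _ ≤ (A * (ly * |cf|⁻¹) * E * s) ^ 2 * (Lr * Eh) ^ 2 := mul_le_mul_of_nonneg_left hLE (sq_nonneg _)
    _ = (A * Lr * (ly * |cf|⁻¹) * (E * Eh) * s) ^ 2 := by ring
    _ = (A * Lr * (ly * |cf|⁻¹) * Real.exp (-(δ / 2 * (geomT D).dist y y')) * s) ^ 2 := by rw [hE2]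

end PairLen

/-! ## §3  (2.140)₂ at k levels modulo a displayed (2.136)₃-shape majorant of the transpose -/

section GradModulo

/-- **PROPOSITION 2.6, THE SECOND `L²` ENTRY OF (2.140) `‖ζ∇GJ‖ ≤ O(1)Lʲη|ζ|e^{−δ₃d(y,y′)}‖J‖` AT k LEVELS FOR THE GENUINE `G`, MODULO THE SUP ENTRY
(2.136)₃** — for every odd `L ≥ 5`, `k ≥ 1`, `P′_μ ≥ 5L` (binders of p38's `prop26_2136_grad_kLevel_unconditional_pad_V1` VERBATIM with `α < 1`,
`M₂` enlarged; its second conjunct = the (2.136)₂ majorant of `∇_νG = DV ν c′ ∘ onFun G` BY NAME) and every direction `ν`: IF some endomorphism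
`T′` with the transposed entries of `∇_νG` (print's `G∇_ν*`, as `G† = G`) carries a (2.136)₃-shape majorant `A′·(len y·|c′|⁻¹)·e^{−δ₃(α,2σ)d_T}`
with ANY constant `A′ ≥ 0` (the displayed hypothesis; not in the tree), THEN `Σ_x (ζ(x)(∇_νGJ)(x))² ≤ (max(A,A′)·L·(len y·|c′|⁻¹)·
e^{−(δ₃(α,2σ)/2)d_T(y,y′)}·s)²·Σ_x J(x)²` for `supp ζ ⊂ Δ(y)`, `|ζ| ≤ s`, `supp J ⊂ Δ(y′)` (both majorants raised to `max(A,A′)` by monotonicity). [cite: Balaban1984PropagatorsII, Prop. 2.6 (2.140) p.247 (second entry), (2.136) p.247, (2.2) p.224] -/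
theorem ineq2140_grad_kLevel_pad_V1_of_transpose (d ℓ : ℕ) (hd : 1 ≤ d + 1) (hL : Odd (ℓ + 1) ∧ 1 < ℓ + 1) {b₀ b₁ : ℝ}
    (hb₀ : 0 < b₀) (hb₁ : b₀ ≤ b₁) :
    ∃ σ₁ : ℝ, 0 < σ₁ ∧ ∀ (σ : ℝ), 0 < σ → σ ≤ σ₁ → ∀ (α : ℝ), 0 < α → α < 1 →
    ∃ A M₂ : ℝ, 0 ≤ A ∧ 0 < M₂ ∧
    ∀ (m K : ℕ) {Mh k R : ℕ} {P' : Fin (d + 1) → ℕ}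
      (hN : ∀ μ, N0 ℓ Mh k P' μ = (PV d ℓ m K hd hL).sitesPerDir 0) (D : TDomains d ℓ Mh k P' R) (hk : k ≤ m + K) (_ : 1 ≤ k)
      {a : ℕ} (_ : Mh = (ℓ + 1) ^ a) (_ : 8 ≤ Mh) (_ : 2 * (ℓ + 1) ^ 2 ≤ R) (_ : ∀ μ, 5 * (ℓ + 1) ≤ P' μ) (_ : 4 ≤ ℓ)
      (_ : M₂ ≤ ((ℓ : ℝ) + 1) * Mh)
      {cf : ℝ} (hcf : cf ≠ 0) {w : BondIdx (domT hN D hk) → ℝ} (hw : ∀ i, 0 < w i) (_ : GlobalBand b₀ b₁ cf w) (ν : Fin (d + 1))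
      (A' : ℝ) (_ : 0 ≤ A') (T' : Module.End ℝ (PBond (PV d ℓ m K hd hL) 0 → ℝ))
      (_ : ∀ x x', T' (Pi.single x 1) x' = (DV ν cf ∘ₗ onFun (GE (domT hN D hk) hcf hw)) (Pi.single x' 1) x)
      (_ : HasMajorant (g := geomT D) (blkV1 hN D) T'
        (fun y y' => A' * ((geomT D).len y * |cf|⁻¹) * Real.exp (-(delta3 α (2 * σ) * (geomT D).dist y y'))))
      (y y' : (geomT D).Site) (ζ J : PBond (PV d ℓ m K hd hL) 0 → ℝ) {s : ℝ}
      (_ : ∀ x, blkV1 hN D x ≠ y → ζ x = 0) (_ : ∀ x, |ζ x| ≤ s) (_ : ∀ x, blkV1 hN D x ≠ y' → J x = 0),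
      ∑ x, (ζ x * (DV ν cf ∘ₗ onFun (GE (domT hN D hk) hcf hw)) J x) ^ 2 ≤
        (max A A' * ((ℓ : ℝ) + 1) * ((geomT D).len y * |cf|⁻¹) * Real.exp (-(delta3 α (2 * σ) / 2 * (geomT D).dist y y')) * s) ^ 2 *
          ∑ x, J x ^ 2 := by
  obtain ⟨σ₁, hσ₁, h⟩ := prop26_2136_grad_kLevel_unconditional_pad_V1 d ℓ hd hL hb₀ hb₁
  refine ⟨σ₁, hσ₁, fun σ hσ hσ1 α hα hα1 => ?_⟩
  obtain ⟨A, M₂, hA, hM₂, h2⟩ := h σ hσ hσ1 α hα hα1.le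
  have hδ : 0 < delta3 α (2 * σ) := delta3_pos hα1 (by linarith)
  refine ⟨A, max M₂ (2 * Real.log ((ℓ : ℝ) + 1) / delta3 α (2 * σ) + 1), hA, lt_max_of_lt_left hM₂, ?_⟩
  intro m K Mh k R P' hN D hk hk1 a hMha hM8 hR2 hP5L hℓ hM cf hcf w hw hwb ν A' hA' T' htr hT' y y' ζ J s hζ hζs hJ
  have hT := (h2 m K hN D hk hk1 hMha hM8 hR2 hP5L hℓ ((le_max_left _ _).trans hM) hcf hw hwb).2 ν
  have habs := absorb_of_threshold (R := R) hδ (by omega) (by omega) hR2 ((le_max_right _ _).trans hM)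
  -- raise both constants to `max A A′`
  have hfac : ∀ (B : ℝ) (y₁ y₂ : (geomT D).Site), B ≤ max A A' →
      B * ((geomT D).len y₁ * |cf|⁻¹) * Real.exp (-(delta3 α (2 * σ) * (geomT D).dist y₁ y₂)) ≤
        max A A' * ((geomT D).len y₁ * |cf|⁻¹) * Real.exp (-(delta3 α (2 * σ) * (geomT D).dist y₁ y₂)) := by
    intro B y₁ y₂ hB
    have hl : 0 ≤ (geomT D).len y₁ * |cf|⁻¹ :=
      mul_nonneg (by rw [geomT_len_eq]; positivity) (inv_nonneg.mpr (abs_nonneg _))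
    exact mul_le_mul_of_nonneg_right (mul_le_mul_of_nonneg_right hB hl) (Real.exp_nonneg _)
  have hTm := hasMajorant_mono (g := geomT D) (blkV1 hN D) hT (fun y₁ y₂ => hfac A y₁ y₂ (le_max_left _ _))
  have hTm' := hasMajorant_mono (g := geomT D) (blkV1 hN D) hT' (fun y₁ y₂ => hfac A' y₁ y₂ (le_max_right _ _))
  exact sum_sq_le_of_hasMajorant_pair_len hN D (by omega) (fun μ => le_trans (by omega) (hP5L μ)) cf htr (le_max_of_le_left hA) hδ.le habs
    hTm hTm'
    y y' ζ J hζ hζs hJ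

end GradModulo

/-! ## §4  The operator form on `ℓ²(fine bonds)`: `|⟪v, Gu⟫| ≤ A·L·pref(y)·e^{−(δ/2)d_T}·‖v‖‖u‖` for `v`, `u` supported in the blocks `y`, `y′` -/

section InnerForm

variable {d ℓ m K : ℕ} {hd : 1 ≤ d + 1} {hL : Odd (ℓ + 1) ∧ 1 < ℓ + 1} {Mh k R : ℕ} {P' : Fin (d + 1) → ℕ}

/-- **THE `ℓ²`-BLOCK FORM OF (2.140)₁** (the shape consumed by the `ℓ²` block calculus `B6L2BlockCalculus.l2blk_*`): under the landed-shape majorant of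
`onFun G` and the threshold, for `v` supported in the block `Δ(y)` and `u` in `Δ(y′)` of the V1 torus, `|⟪v, Gu⟫| ≤ A·L·pref cf y·e^{−(δ/2)d_T(y,y′)}·‖v‖‖u‖` —
i.e. the operator norm of the block `1_{Δ(y)}G1_{Δ(y′)}` of the genuine `G = Δ_a⁻¹` on `ℓ²` (from `sum_sq_le_of_hasMajorant_GE` with the indicator cut-off
and Cauchy–Schwarz). [cite: Balaban1984PropagatorsII, Prop. 2.6 (2.140) p.247 (first entry); derivation ours] -/
theorem abs_inner_GE_le (hN : ∀ μ, N0 ℓ Mh k P' μ = (PV d ℓ m K hd hL).sitesPerDir 0) (D : TDomains d ℓ Mh k P' R)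
    (hk : k ≤ m + K) (hMh : 1 ≤ Mh) (hP : ∀ μ, 1 ≤ P' μ) {cf : ℝ} (hcf : cf ≠ 0) {w : BondIdx (domT hN D hk) → ℝ} (hw : ∀ i, 0 < w i)
    {A δ : ℝ} (hA : 0 ≤ A) (hδ : 0 ≤ δ) (habs : 2 * Real.log ((ℓ : ℝ) + 1) ≤ δ * (((R * ((ℓ + 1) * Mh) - 1 : ℕ)) : ℝ))
    (hT : HasMajorant (g := geomT D) (blkV1 hN D) (onFun (GE (domT hN D hk) hcf hw))
      (fun y y' => A * pref cf y * Real.exp (-(δ * (geomT D).dist y y'))))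
    (y y' : (geomT D).Site) (v u : BondSpace (PV d ℓ m K hd hL))
    (hv : ∀ x, blkV1 hN D x ≠ y → v x = 0) (hu : ∀ x, blkV1 hN D x ≠ y' → u x = 0) :
    |⟪v, GE (domT hN D hk) hcf hw u⟫_ℝ| ≤
      A * ((ℓ : ℝ) + 1) * pref cf y * Real.exp (-(δ / 2 * (geomT D).dist y y')) * (‖v‖ * ‖u‖) := by
  classical
  set G := GE (domT hN D hk) hcf hw with hG
  set B : ℝ := A * ((ℓ : ℝ) + 1) * pref cf y * Real.exp (-(δ / 2 * (geomT D).dist y y')) with hB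
  have hB0 : 0 ≤ B := by
    rw [hB]; exact mul_nonneg (mul_nonneg (mul_nonneg hA (by positivity)) (pref_nonneg cf y)) (Real.exp_nonneg _)
  -- the indicator cut-off of the block `Δ(y)`
  set ζ : PBond (PV d ℓ m K hd hL) 0 → ℝ := fun x => if blkV1 hN D x = y then 1 else 0 with hζ
  have hζ0 : ∀ x, blkV1 hN D x ≠ y → ζ x = 0 := fun x hx => by simp only [hζ, hx, if_false]
  have hζ1 : ∀ x, |ζ x| ≤ 1 := fun x => by
    by_cases hx : blkV1 hN D x = y
    · simp only [hζ, hx, if_true, abs_one, le_refl]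
    · simp only [hζ, hx, if_false, abs_zero, zero_le_one]
  have hsq := sum_sq_le_of_hasMajorant_GE hN D hk hMh hP hcf hw hA hδ habs hT y y' ζ (WithLp.ofLp u) hζ0 hζ1
    (fun x hx => hu x hx)
  rw [mul_one] at hsq
  -- `⟪v, Gu⟫ = Σ_x v(x)·(ζ(x)(Gu)(x))`
  have hGu : ∀ x, onFun G (WithLp.ofLp u) x = G u x := fun x => rfl
  have hinner : ⟪v, G u⟫_ℝ = ∑ x, v x * (ζ x * onFun G (WithLp.ofLp u) x) := by
    rw [inner_eq_sum]
    refine Finset.sum_congr rfl fun x _ => ?_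
    by_cases hx : blkV1 hN D x = y
    · rw [hGu]; simp only [hζ, hx, if_true, one_mul]
    · rw [hv x hx, zero_mul, zero_mul]
  have hCS := Finset.sum_mul_sq_le_sq_mul_sq univ (fun x => v x) (fun x => ζ x * onFun G (WithLp.ofLp u) x)
  have hv2 : ∑ x, v x ^ 2 = ‖v‖ ^ 2 := (EuclideanSpace.real_norm_sq_eq v).symm
  have hu2 : ∑ x, (WithLp.ofLp u) x ^ 2 = ‖u‖ ^ 2 := (EuclideanSpace.real_norm_sq_eq u).symm
  have hsq' : ⟪v, G u⟫_ℝ ^ 2 ≤ (B * (‖v‖ * ‖u‖)) ^ 2 := by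
    rw [hinner]
    calc (∑ x, v x * (ζ x * onFun G (WithLp.ofLp u) x)) ^ 2
        ≤ (∑ x, v x ^ 2) * ∑ x, (ζ x * onFun G (WithLp.ofLp u) x) ^ 2 := hCS
      _ ≤ ‖v‖ ^ 2 * (B ^ 2 * ∑ x, (WithLp.ofLp u) x ^ 2) := by
          rw [hv2]; exact mul_le_mul_of_nonneg_left hsq (sq_nonneg _)
      _ = (B * (‖v‖ * ‖u‖)) ^ 2 := by rw [hu2]; ring
  exact abs_le_of_sq_le_sq hsq' (mul_nonneg hB0 (by positivity))

end InnerForm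

end Literature.MathematicalPhysics.QuantumFieldTheory.Balaban1983to89.B6Ineq2140KLevelPadV1

end
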